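import Literature.Probability.Percolation.ChemicalDistance
import Literature.Probability.Percolation.FiniteEnergy
import Literature.Probability.Percolation.MeanFieldBetaFromGamma
import Literature.Probability.Percolation.AnchoredProfileVanishing
import Literature.Barriers.CriticalPhenomena.KozmaNachmiasLemma43
import HarnessLib

/-!
# Kozma–Nachmias' thin-layer recursion for the chemical one-arm probability on `ℤ^d`

Topic `Literature/Probability/Percolation`.  G. Kozma, A. Nachmias, *The Alexander–Orbach conjecture
holds in high dimensions*, Invent. Math. 178 (2009), §3.2, proof of Theorem 1.2 (ii), display (claim):
for Bernoulli bond percolation on `ℤ^d` (ANY `d`, ANY `p` — no high-dimensional input enters here),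

  `P( ∂B(0, 3^k; G) ≠ ∅ and |C_G(0)| ≤ ε 9^k ) ≤ ε 3^{k+1} · Γ(3^{k-1})²`,

uniformly in the sub-edge-set `G ⊂ E(ℤ^d)`, where `Γ(r) = sup_G P(∂B(0,r;G) ≠ ∅)` (their §1.3).
Proof (theirs): if `|C_G(0)| ≤ ε 9^k` some level `j ∈ [3^k/3, 2·3^k/3]` has `≤ ε 3^{k+1}` sites
(pigeonhole); reaching that level costs `Γ(3^{k-1})`; conditionally on the ball `B(0,j;G)` — a
function of the edges touching `B(0,j-1;G)` only — one of its `≤ ε 3^{k+1}` boundary sites must reach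
chemical distance `3^{k-1}` in the graph `G₂` with those edges removed, an event independent of the
ball and of probability `≤ Γ(3^{k-1})` (the supremum over subgraphs absorbs `G₂`).

This file formalises exactly this, in the form (`m ≥ 1`, `V > 0` real, `v` any base point,
`K ≤ zdGraph d` any step graph; `Chemical.armSup d p r = Γ(r)`, the supremum being taken over base
points as well, which is the same number by translation invariance and spares a relabelling):

* `Chemical.real_far_inter_small_le` —
  `P( H_v(3m; K) ∩ {|C_K(v)| ≤ V} ) ≤ (V/m) · Γ(m)²`;
* `Chemical.armSup_three_mul_le` — `Γ(3m) ≤ (V/m) Γ(m)² + P(|C(0)| ≥ ⌊V⌋ + 1)`.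

The ingredients are the deterministic lemmas of `ChemicalDistance.lean` (thin level, locality of the
balls, geodesic suffix) and the tree's disjoint-support independence
`bondPercolation_real_inter_of_disjoint` (`FiniteEnergy.lean`).

## References

* G. Kozma, A. Nachmias, Invent. Math. 178 (2009) 635–654, §3.2 (proof of Thm. 1.2(ii), (claim)).
* G. Grimmett, *Percolation*, 2nd ed. 1999, §2.2 (independence of events on disjoint edge sets).
-/

noncomputable section

namespace Literature.Probability.Percolation

open MeasureTheory LatticeModels

namespace Chemical

variable {d : ℕ}

/-! ## Step graphs below the lattice are locally finite -/

/-- A step graph below a locally finite graph is locally finite. [folklore] -/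
@[reducible] private def locallyFiniteOfLE {V : Type*} {G H : SimpleGraph V} [H.LocallyFinite] (h : G ≤ H) :
    G.LocallyFinite := fun v =>
  ((H.neighborSet v).toFinite.subset fun _ hw => h hw).fintype

/-! ## `Γ(r)`: the supremum of the chemical one-arm probabilities -/

/-- **`Γ(r)`** (Kozma–Nachmias 2009, §1.3): the supremum over base points `x` and step graphs
`K ≤ ℤ^d` of `P_p(∂B(x, r; K) ≠ ∅)`.  (KN take the supremum over sub-edge-sets with the base point at
the origin; by translation invariance of `P_p` the two suprema coincide.)
[cite: KozmaNachmias2009, §1.3 (definition of Γ(r))] -/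
def armSup (d : ℕ) (p : unitInterval) (r : ℕ) : ℝ :=
  ⨆ q : Site d × {K : SimpleGraph (Site d) // K ≤ zdGraph d},
    (bondPercolation (zdGraph d) p).real (far q.2.1 q.1 r)

/-- The family defining `Γ(r)` is bounded by `1`. [folklore] -/
private theorem bddAbove_range_far (d : ℕ) (p : unitInterval) (r : ℕ) :
    BddAbove (Set.range fun q : Site d × {K : SimpleGraph (Site d) // K ≤ zdGraph d} =>
      (bondPercolation (zdGraph d) p).real (far q.2.1 q.1 r)) :=
  ⟨1, by rintro _ ⟨q, rfl⟩; exact measureReal_le_one⟩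

/-- `P_p(∂B(v, r; K) ≠ ∅) ≤ Γ(r)` for every base point and every `K ≤ ℤ^d`.
[cite: KozmaNachmias2009, §1.3 (Γ(r))] -/
theorem real_far_le_armSup {K : SimpleGraph (Site d)} (hK : K ≤ zdGraph d) (p : unitInterval)
    (v : Site d) (r : ℕ) : (bondPercolation (zdGraph d) p).real (far K v r) ≤ armSup d p r :=
  le_ciSup (bddAbove_range_far d p r) (⟨v, ⟨K, hK⟩⟩ : Site d × {K : SimpleGraph (Site d) // K ≤ zdGraph d})

/-- `Γ(r) ≤ 1`. [cite: KozmaNachmias2009, §1.3 (Γ(r))] -/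
theorem armSup_le_one (d : ℕ) (p : unitInterval) (r : ℕ) : armSup d p r ≤ 1 := by
  haveI : Nonempty (Site d × {K : SimpleGraph (Site d) // K ≤ zdGraph d}) := ⟨⟨0, ⟨⊥, bot_le⟩⟩⟩
  exact ciSup_le fun _ => measureReal_le_one

/-- `0 ≤ Γ(r)`. [cite: KozmaNachmias2009, §1.3 (Γ(r))] -/
theorem armSup_nonneg (d : ℕ) (p : unitInterval) (r : ℕ) : 0 ≤ armSup d p r :=
  Real.iSup_nonneg fun _ => measureReal_nonneg

/-- `Γ` is non-increasing. [cite: KozmaNachmias2009, §1.3 (Γ(r))] -/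
theorem armSup_antitone (d : ℕ) (p : unitInterval) : Antitone (armSup d p) := by
  intro r s hrs
  haveI : Nonempty (Site d × {K : SimpleGraph (Site d) // K ≤ zdGraph d}) := ⟨⟨0, ⟨⊥, bot_le⟩⟩⟩
  refine ciSup_le fun q => ?_
  calc (bondPercolation (zdGraph d) p).real (far q.2.1 q.1 s)
      ≤ (bondPercolation (zdGraph d) p).real (far q.2.1 q.1 r) :=
        measureReal_mono (far_antitone _ _ hrs) (measure_ne_top _ _)
    _ ≤ armSup d p r := real_far_le_armSup q.2.2 p q.1 r

/-! ## Balls of a lattice step graph lie in lattice boxes -/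

/-- The lattice box of radius `n` around `v`. [folklore] -/
private def vbox (v : Site d) (n : ℕ) : Finset (Site d) := (box d n).image fun y => v + y

/-- `B(v, i; K) ⊆ v + Λ_n` for `K ≤ ℤ^d` and `i ≤ n`: an open `K`-path of length `≤ i` moves every
coordinate by at most `i`. [folklore] -/
private theorem ball_subset_vbox {K : SimpleGraph (Site d)} (hK : K ≤ zdGraph d) (v : Site d) {i n : ℕ}
    (hin : i ≤ n) (ω : BondConfig (Site d)) : ball K v i ω ⊆ ↑(vbox v n) := by
  rintro z ⟨w, hw⟩
  simp only [vbox, Finset.coe_image, Set.mem_image, Finset.mem_coe, mem_box]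
  refine ⟨z - v, fun c => ?_, by abel⟩
  have h := CerfDembinVanishing.abs_sub_le_length (le_trans inf_le_right hK) w c
  have h' : |z c - v c| ≤ (n : ℤ) := h.trans (by exact_mod_cast hw.trans hin)
  simpa [Pi.sub_apply] using abs_le.1 h'

/-! ## The recursion -/

section Recursion

/-- The pieces of Kozma–Nachmias' decomposition: `j` is the FIRST level in `[m, 2m)` with at most
`V/m` sites, `S = B(v, j-1; K)`, `L = ∂B(v, j; K)` non-empty. [cite: KozmaNachmias2009, §3.2 (the first thin level j)] -/
def piece (K : SimpleGraph (Site d)) (v : Site d) (m : ℕ) (V₀ : ℝ) (j : ℕ) (S L : Finset (Site d)) :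
    Set (BondConfig (Site d)) :=
  {ω | ball K v (j - 1) ω = ↑S ∧ level K v j ω = ↑L ∧
    (∀ i, m ≤ i → i < j → V₀ / m < ((level K v i ω).ncard : ℝ)) ∧ (L.card : ℝ) ≤ V₀ / m ∧ L.Nonempty}

/-- The lattice edges touching `S`, as a finite set. [folklore] -/
private theorem coe_edgesTouching (S : Finset (Site d)) :
    (↑(LatticeModels.edgesTouching (zdGraph d) S) : Set (Sym2 (Site d))) =
      {e | e ∈ (zdGraph d).edgeSet ∧ ∃ y ∈ (↑S : Set (Site d)), y ∈ e} := by
  ext e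
  simp only [LatticeModels.edgesTouching, Finset.coe_biUnion, Finset.mem_coe, Set.mem_iUnion, SimpleGraph.mem_incidenceFinset,
    SimpleGraph.incidenceSet, Set.mem_setOf_eq]
  constructor
  · rintro ⟨y, hy, he, hye⟩; exact ⟨he, y, hy, hye⟩
  · rintro ⟨he, y, hy, hye⟩; exact ⟨y, hy, he, hye⟩

/-- **The pieces are determined by the lattice edges touching `S`** (locality of the balls,
`ball_eq_of_agree`). [cite: KozmaNachmias2009, §3.2 (edges needed to calculate B(0,j;G))] -/
theorem determinedBy_piece {K : SimpleGraph (Site d)} (hK : K ≤ zdGraph d) {v : Site d} {m : ℕ} (hm : 1 ≤ m)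
    (V₀ : ℝ) {j : ℕ} (hj : m ≤ j) (S L : Finset (Site d)) :
    DeterminedBy (piece K v m V₀ j S L) ↑(LatticeModels.edgesTouching (zdGraph d) S) := by
  rw [determinedBy_iff]
  -- it suffices to transfer membership one way, for a symmetric agreement hypothesis
  suffices key : ∀ ω ω' : BondConfig (Site d),
      ω ∩ ↑(LatticeModels.edgesTouching (zdGraph d) S) = ω' ∩ ↑(LatticeModels.edgesTouching (zdGraph d) S) →
      ω ∈ piece K v m V₀ j S L → ω' ∈ piece K v m V₀ j S L from
    fun ω ω' h => ⟨key ω ω' h, key ω' ω h.symm⟩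
  intro ω ω' h hω
  obtain ⟨hS, hL, hthick, hcard, hne⟩ := hω
  -- agreement on the `K`-edges touching `B(v, j-1; K)(ω) = S`
  have hagree : ∀ e ∈ K.edgeSet, (∃ y ∈ ball K v (j - 1) ω, y ∈ e) → (e ∈ ω ↔ e ∈ ω') := by
    intro e he hy
    rw [hS] at hy
    have hmem : e ∈ (↑(LatticeModels.edgesTouching (zdGraph d) S) : Set (Sym2 (Site d))) := by
      rw [coe_edgesTouching]
      exact ⟨SimpleGraph.edgeSet_subset_edgeSet.2 hK he, hy⟩
    constructor
    · intro heω
      have : e ∈ ω' ∩ ↑(LatticeModels.edgesTouching (zdGraph d) S) := h ▸ ⟨heω, hmem⟩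
      exact this.1
    · intro heω'
      have : e ∈ ω ∩ ↑(LatticeModels.edgesTouching (zdGraph d) S) := h.symm ▸ ⟨heω', hmem⟩
      exact this.1
  have hj1 : j - 1 + 1 = j := by omega
  refine ⟨?_, ?_, fun i hmi hij => ?_, hcard, hne⟩
  · rw [ball_eq_of_agree hagree (by omega), hS]
  · have := level_eq_of_agree hagree (i := j) (by omega)
    rw [this, hL]
  · rw [level_eq_of_agree hagree (i := i) (by omega)]
    exact hthick i hmi hij

/-- The pieces are measurable (finitely determined). [cite: KozmaNachmias2009, §3.2 proof of Thm. 1.2(ii)] -/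
theorem measurableSet_piece {K : SimpleGraph (Site d)} (hK : K ≤ zdGraph d) {v : Site d} {m : ℕ} (hm : 1 ≤ m)
    (V₀ : ℝ) {j : ℕ} (hj : m ≤ j) (S L : Finset (Site d)) :
    MeasurableSet (piece K v m V₀ j S L) :=
  (determinedBy_piece hK hm V₀ hj S L).measurableSet_of_finset

/-- **Distinct pieces are disjoint**: the index `j` is the first thin level, and `S`, `L` are functions
of the configuration and `j`. [cite: KozmaNachmias2009, §3.2 proof of Thm. 1.2(ii)] -/
theorem disjoint_piece {K : SimpleGraph (Site d)} {v : Site d} {m : ℕ} (V₀ : ℝ) {j j' : ℕ}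
    {S L S' L' : Finset (Site d)}
    (hne : (j, S, L) ≠ (j', S', L')) (hj : m ≤ j) (hj' : m ≤ j') :
    Disjoint (piece K v m V₀ j S L) (piece K v m V₀ j' S' L') := by
  rw [Set.disjoint_left]
  rintro ω ⟨hS, hL, hthick, hcard, -⟩ ⟨hS', hL', hthick', hcard', -⟩
  rcases lt_trichotomy j j' with hlt | rfl | hgt
  · have := hthick' j hj hlt
    rw [hL, Set.ncard_coe_finset] at this
    linarith
  · apply hne
    have h1 : S = S' := Finset.coe_injective (hS.symm.trans hS')
    have h2 : L = L' := Finset.coe_injective (hL.symm.trans hL')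
    rw [h1, h2]
  · have := hthick j' hj' hgt
    rw [hL', Set.ncard_coe_finset] at this
    linarith

/-- Each piece lies in `H_v(m; K)` (its level `L = ∂B(v,j;K)`, `j ≥ m`, is non-empty). [cite: KozmaNachmias2009, §3.2 proof of Thm. 1.2(ii)] -/
theorem piece_subset_far {K : SimpleGraph (Site d)} {v : Site d} {m : ℕ} (V₀ : ℝ) {j : ℕ} (hj : m ≤ j)
    (S L : Finset (Site d)) :
    piece K v m V₀ j S L ⊆ far K v m := by
  rintro ω ⟨-, hL, -, -, ⟨z, hz⟩⟩
  have hz' : z ∈ level K v j ω := by rw [hL]; exact hz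
  exact mem_far_of_mem_level hz' hj

/-- The index set of the decomposition: `m ≤ j < 2m`, `S, L ⊆ v + Λ_{2m}`. [cite: KozmaNachmias2009, §3.2 proof of Thm. 1.2(ii)] -/
def pieceIndex (v : Site d) (m : ℕ) : Finset (ℕ × Finset (Site d) × Finset (Site d)) :=
  Finset.Ico m (2 * m) ×ˢ ((vbox v (2 * m)).powerset ×ˢ (vbox v (2 * m)).powerset)

/-- **Covering**: on `H_v(3m; K) ∩ {|C_K(v)| ≤ V}` the configuration lies in the piece indexed by its
first thin level `j ∈ [m, 2m)`, `S = B(v,j-1;K)`, `L = ∂B(v,j;K)`. [cite: KozmaNachmias2009, §3.2 (choice of the first thin level)] -/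
theorem far_inter_small_subset {K : SimpleGraph (Site d)} (hK : K ≤ zdGraph d) {v : Site d} {m : ℕ}
    (hm : 1 ≤ m) (V₀ : ℝ) :
    far K v (3 * m) ∩ {ω | (openClusterIn K ω v).Finite ∧ ((openClusterIn K ω v).ncard : ℝ) ≤ V₀} ⊆
      ⋃ i ∈ pieceIndex v m, (piece K v m V₀ i.1 i.2.1 i.2.2 ∩ far K v (3 * m)) := by
  classical
  rintro ω ⟨hfar, hfin, hV⟩
  -- the first thin level
  have hex : ∃ j, m ≤ j ∧ j < 2 * m ∧ (level K v j ω).Finite ∧ ((level K v j ω).ncard : ℝ) ≤ V₀ / m :=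
    exists_thin_level hfin hV hm
  let j := Nat.find hex
  obtain ⟨hmj, hj2, hlf, hthin⟩ : m ≤ j ∧ j < 2 * m ∧ (level K v j ω).Finite ∧
      ((level K v j ω).ncard : ℝ) ≤ V₀ / m := Nat.find_spec hex
  have hfirst : ∀ i, m ≤ i → i < j → V₀ / m < ((level K v i ω).ncard : ℝ) := by
    intro i hmi hij
    have hnot := Nat.find_min hex hij
    have hif : (level K v i ω).Finite := hfin.subset (level_subset_openClusterIn K v i ω)
    by_contra hle
    exact hnot ⟨hmi, by omega, hif, not_lt.1 hle⟩
  have hbf : (ball K v (j - 1) ω).Finite := hfin.subset (ball_subset_openClusterIn K v _ ω)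
  set S := hbf.toFinset with hSdef
  set L := hlf.toFinset with hLdef
  have hS : ball K v (j - 1) ω = ↑S := by rw [hSdef, Set.Finite.coe_toFinset]
  have hL : level K v j ω = ↑L := by rw [hLdef, Set.Finite.coe_toFinset]
  have hLne : L.Nonempty := by
    rw [hLdef, Set.Finite.toFinset_nonempty]
    exact level_nonempty_of_far hfar (by omega)
  have hLcard : (L.card : ℝ) ≤ V₀ / m := by
    rwa [hLdef, ← Set.ncard_eq_toFinset_card _ hlf]
  rw [Set.mem_iUnion₂]
  refine ⟨(j, S, L), ?_, ⟨hS, hL, hfirst, hLcard, hLne⟩, hfar⟩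
  simp only [pieceIndex, Finset.mem_product, Finset.mem_Ico, Finset.mem_powerset]
  refine ⟨⟨hmj, hj2⟩, ?_, ?_⟩
  · rw [← Finset.coe_subset, ← hS]
    exact ball_subset_vbox hK v (by omega) ω
  · rw [← Finset.coe_subset, ← hL]
    exact (level_subset_ball K v j ω).trans (ball_subset_vbox hK v (by omega) ω)

/-- **The regeneration bound for one piece**: `P(piece ∩ H_v(3m;K)) ≤ P(piece) · (V/m) · Γ(m)`.
On the piece, a geodesic to chemical distance `3m` leaves the thin level `L` at one of its `≤ V/m`
sites `x` and continues for `≥ m` steps in the graph `K'` with all edges touching `S` deleted; the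
piece reads only edges touching `S`, the continuation only edges of `K'`, so the two are independent,
and `P(∂B(x, m; K') ≠ ∅) ≤ Γ(m)`. [cite: KozmaNachmias2009, §3.2 proof of Thm. 1.2(ii) (Markov property, display before (claim))] -/
theorem real_piece_inter_far_le {K : SimpleGraph (Site d)} (hK : K ≤ zdGraph d) {p : unitInterval} {v : Site d}
    {m : ℕ} (hm : 1 ≤ m) (V₀ : ℝ) {j : ℕ} (hj : m ≤ j) (hj2 : j < 2 * m) (S L : Finset (Site d)) :
    (bondPercolation (zdGraph d) p).real (piece K v m V₀ j S L ∩ far K v (3 * m)) ≤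
      (bondPercolation (zdGraph d) p).real (piece K v m V₀ j S L) * (V₀ / m * armSup d p m) := by
  classical
  set A := piece K v m V₀ j S L with hA
  set K' := K.deleteEdges (touching (↑S : Set (Site d))) with hK'def
  have hK' : K' ≤ zdGraph d := (SimpleGraph.deleteEdges_le _).trans hK
  haveI : K'.LocallyFinite := locallyFiniteOfLE hK'
  -- empty piece if `L` is too big
  by_cases hLcard : (L.card : ℝ) ≤ V₀ / m
  swap
  · have hAempty : A = ∅ := Set.eq_empty_of_forall_notMem fun ω hω => hLcard hω.2.2.2.1
    simp [hAempty]
  -- the geodesic suffix: `A ∩ H_v(3m;K) ⊆ ⋃_{x ∈ L} (A ∩ H_x(m; K'))`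
  have hcover : A ∩ far K v (3 * m) ⊆ ⋃ x ∈ L, (A ∩ far K' x m) := by
    rintro ω ⟨hω, hfar⟩
    have hS := hω.1
    have hL := hω.2.1
    obtain ⟨x, hx, hxfar⟩ := exists_far_deleteEdges (n := j - 1) hfar (by omega)
    have hj1 : j - 1 + 1 = j := by omega
    rw [hj1] at hx hxfar
    rw [hS] at hxfar
    rw [Set.mem_iUnion₂]
    refine ⟨x, by rw [← Finset.mem_coe, ← hL]; exact hx, hω, ?_⟩
    exact far_antitone K' x (show m ≤ 3 * m - j by omega) hxfar
  -- independence piece / continuation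
  have hindep : ∀ x, (bondPercolation (zdGraph d) p).real (A ∩ far K' x m) = (bondPercolation (zdGraph d) p).real A * (bondPercolation (zdGraph d) p).real (far K' x m) := by
    intro x
    refine bondPercolation_real_inter_of_disjoint (zdGraph d) p ?_ (determinedBy_piece hK hm V₀ hj S L)
      (determinedBy_far K' x m) (measurableSet_piece hK hm V₀ hj S L) (measurableSet_far K' x m)
    rw [Set.disjoint_left]
    intro e he heK'
    rw [coe_edgesTouching] at he
    rw [hK'def, SimpleGraph.edgeSet_deleteEdges] at heK'
    exact heK'.2 he.2
  calc (bondPercolation (zdGraph d) p).real (A ∩ far K v (3 * m))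
      ≤ (bondPercolation (zdGraph d) p).real (⋃ x ∈ L, (A ∩ far K' x m)) :=
        measureReal_mono hcover (measure_ne_top _ _)
    _ ≤ ∑ x ∈ L, (bondPercolation (zdGraph d) p).real (A ∩ far K' x m) := measureReal_biUnion_finset_le _ _
    _ = ∑ x ∈ L, (bondPercolation (zdGraph d) p).real A * (bondPercolation (zdGraph d) p).real (far K' x m) := Finset.sum_congr rfl fun x _ => hindep x
    _ ≤ ∑ _x ∈ L, (bondPercolation (zdGraph d) p).real A * armSup d p m :=
        Finset.sum_le_sum fun x _ => mul_le_mul_of_nonneg_left (real_far_le_armSup hK' p x m) measureReal_nonneg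
    _ = L.card * ((bondPercolation (zdGraph d) p).real A * armSup d p m) := by rw [Finset.sum_const, nsmul_eq_mul]
    _ ≤ V₀ / m * ((bondPercolation (zdGraph d) p).real A * armSup d p m) :=
        mul_le_mul_of_nonneg_right hLcard (mul_nonneg measureReal_nonneg (armSup_nonneg d p m))
    _ = (bondPercolation (zdGraph d) p).real A * (V₀ / m * armSup d p m) := by ring

/-- **Kozma–Nachmias' claim**: `P( ∂B(v, 3m; K) ≠ ∅, |C_K(v)| ≤ V ) ≤ (V/m) · Γ(m)²` for every
`m ≥ 1`, `V > 0`, base point `v` and step graph `K ≤ ℤ^d` (KN09: `m = 3^{k-1}`, `V = ε 9^k`).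
[cite: KozmaNachmias2009, §3.2 proof of Thm. 1.2(ii), display (claim)] -/
theorem real_far_inter_small_le {K : SimpleGraph (Site d)} (hK : K ≤ zdGraph d) {p : unitInterval} {v : Site d}
    {m : ℕ} (hm : 1 ≤ m) {V₀ : ℝ} (hV₀ : 0 < V₀) :
    (bondPercolation (zdGraph d) p).real
        (far K v (3 * m) ∩ {ω | (openClusterIn K ω v).Finite ∧ ((openClusterIn K ω v).ncard : ℝ) ≤ V₀}) ≤
      V₀ / m * armSup d p m ^ 2 := by
  classical
  set I := pieceIndex v m with hI
  have hIj : ∀ i ∈ I, m ≤ i.1 ∧ i.1 < 2 * m := fun i hi => by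
    simp only [hI, pieceIndex, Finset.mem_product, Finset.mem_Ico] at hi
    exact hi.1
  -- sum of the pieces: disjoint, inside `H_v(m;K)`
  have hsum : ∑ i ∈ I, (bondPercolation (zdGraph d) p).real (piece K v m V₀ i.1 i.2.1 i.2.2) ≤ armSup d p m := by
    rw [← measureReal_biUnion_finset]
    · calc (bondPercolation (zdGraph d) p).real (⋃ i ∈ I, piece K v m V₀ i.1 i.2.1 i.2.2)
          ≤ (bondPercolation (zdGraph d) p).real (far K v m) := measureReal_mono (Set.iUnion₂_subset fun i hi =>
              piece_subset_far V₀ (hIj i hi).1 _ _) (measure_ne_top _ _)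
        _ ≤ armSup d p m := real_far_le_armSup hK p v m
    · intro i hi i' hi' hne
      exact disjoint_piece V₀ (by
        rintro h
        apply hne
        obtain ⟨a, b, c⟩ := i
        obtain ⟨a', b', c'⟩ := i'
        simp only [Prod.mk.injEq] at h
        obtain ⟨rfl, rfl, rfl⟩ := h
        rfl) (hIj i hi).1 (hIj i' hi').1
    · exact fun i hi => measurableSet_piece hK hm V₀ (hIj i hi).1 _ _
  calc (bondPercolation (zdGraph d) p).real (far K v (3 * m) ∩ {ω | (openClusterIn K ω v).Finite ∧ ((openClusterIn K ω v).ncard : ℝ) ≤ V₀})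
      ≤ (bondPercolation (zdGraph d) p).real (⋃ i ∈ I, (piece K v m V₀ i.1 i.2.1 i.2.2 ∩ far K v (3 * m))) :=
        measureReal_mono (far_inter_small_subset hK hm V₀) (measure_ne_top _ _)
    _ ≤ ∑ i ∈ I, (bondPercolation (zdGraph d) p).real (piece K v m V₀ i.1 i.2.1 i.2.2 ∩ far K v (3 * m)) :=
        measureReal_biUnion_finset_le _ _
    _ ≤ ∑ i ∈ I, (bondPercolation (zdGraph d) p).real (piece K v m V₀ i.1 i.2.1 i.2.2) * (V₀ / m * armSup d p m) :=
        Finset.sum_le_sum fun i hi => real_piece_inter_far_le hK hm V₀ (hIj i hi).1 (hIj i hi).2 _ _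
    _ = (∑ i ∈ I, (bondPercolation (zdGraph d) p).real (piece K v m V₀ i.1 i.2.1 i.2.2)) * (V₀ / m * armSup d p m) := by
        rw [Finset.sum_mul]
    _ ≤ armSup d p m * (V₀ / m * armSup d p m) :=
        mul_le_mul_of_nonneg_right hsum (mul_nonneg (div_nonneg hV₀.le (Nat.cast_nonneg _)) (armSup_nonneg d p m))
    _ = V₀ / m * armSup d p m ^ 2 := by ring

end Recursion

/-! ## The recursion for `Γ` with the volume tail -/

/-- `{|C_K(v)| > V}ᶜ`-complement bound: the configurations whose `K`-cluster at `v` is infinite or has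
more than `V` sites lie in `{|C(v)| ≥ ⌊V⌋ + 1}`. [folklore] -/
private theorem compl_small_subset_clusterSizeGe (K : SimpleGraph (Site d)) (v : Site d) {V₀ : ℝ} (hV₀ : 0 ≤ V₀) :
    {ω | (openClusterIn K ω v).Finite ∧ ((openClusterIn K ω v).ncard : ℝ) ≤ V₀}ᶜ ⊆
      clusterSizeGe v (⌊V₀⌋₊ + 1) := by
  intro ω hω
  simp only [Set.mem_compl_iff, Set.mem_setOf_eq, not_and, not_le] at hω
  rw [mem_clusterSizeGe]
  have hsub : openClusterIn K ω v ⊆ openCluster ω v := openClusterIn_subset_openCluster K ω v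
  by_cases hfin : (openClusterIn K ω v).Finite
  · have hlt := hω hfin
    have hnat : ⌊V₀⌋₊ + 1 ≤ (openClusterIn K ω v).ncard := by
      have := Nat.floor_lt hV₀ |>.2 hlt
      omega
    calc ((⌊V₀⌋₊ + 1 : ℕ) : ℕ∞) ≤ (openClusterIn K ω v).ncard := by exact_mod_cast hnat
      _ = (openClusterIn K ω v).encard := hfin.cast_ncard_eq
      _ ≤ (openCluster ω v).encard := Set.encard_le_encard hsub
  · have hinf : (openCluster ω v).Infinite := fun h => hfin (h.subset hsub)
    rw [hinf.encard_eq]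
    exact le_top

/-- **The recursion for `Γ`**: for `m ≥ 1` and real `V > 0`,
`Γ(3m) ≤ (V/m) · Γ(m)² + P_p(|C(0)| ≥ ⌊V⌋ + 1)` (Kozma–Nachmias 2009, §3.2, displays (indstep) and
(claim): `P(H(3^k;G)) ≤ P(∂B ≠ ∅, |C_G(0)| ≤ ε9^k) + P(|C_G(0)| > ε9^k)`, with `|C_G(0)| ≤ |C(0)|`).
[cite: KozmaNachmias2009, §3.2 proof of Thm. 1.2(ii), displays (indstep)–(claim)] -/
theorem armSup_three_mul_le (d : ℕ) (p : unitInterval) {m : ℕ} (hm : 1 ≤ m) {V₀ : ℝ} (hV₀ : 0 < V₀) :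
    armSup d p (3 * m) ≤ V₀ / m * armSup d p m ^ 2 +
      (bondPercolation (zdGraph d) p).real (clusterSizeGe (0 : Site d) (⌊V₀⌋₊ + 1)) := by
  haveI : Nonempty (Site d × {K : SimpleGraph (Site d) // K ≤ zdGraph d}) := ⟨⟨0, ⟨⊥, bot_le⟩⟩⟩
  refine ciSup_le fun q => ?_
  obtain ⟨v, K, hK⟩ := q
  set Sm := {ω : BondConfig (Site d) | (openClusterIn K ω v).Finite ∧ ((openClusterIn K ω v).ncard : ℝ) ≤ V₀}
    with hSm
  calc (bondPercolation (zdGraph d) p).real (far K v (3 * m)) ≤ (bondPercolation (zdGraph d) p).real (far K v (3 * m) ∩ Sm ∪ Smᶜ) :=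
        measureReal_mono (fun ω hω => by
          by_cases h : ω ∈ Sm
          · exact Or.inl ⟨hω, h⟩
          · exact Or.inr h) (measure_ne_top _ _)
    _ ≤ (bondPercolation (zdGraph d) p).real (far K v (3 * m) ∩ Sm) + (bondPercolation (zdGraph d) p).real Smᶜ := measureReal_union_le _ _
    _ ≤ V₀ / m * armSup d p m ^ 2 + (bondPercolation (zdGraph d) p).real (clusterSizeGe (0 : Site d) (⌊V₀⌋₊ + 1)) := by
        refine add_le_add (real_far_inter_small_le hK hm hV₀) ?_
        rw [← Literature.Barriers.CriticalPhenomena.real_clusterSizeGe_eq_zero p v]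
        exact measureReal_mono (compl_small_subset_clusterSizeGe K v hV₀.le) (measure_ne_top _ _)

end Chemical

end Literature.Probability.Percolation

end
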